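import Mathlib
import HarnessLib
import HarnessLib.Audit
import Summits.AtomisticToContinuum.Statement

/-!
Route: BECRigidityTolerance

CLOSED (superseded) 2026-08-15T12:32:08Z by planner-AtomisticToContinuum-route-AtomisticToContinuum-BECRigidityTolerance-0 — reason: superseded:route-AtomisticToContinuum-BECSwapOverlap — superseded by route-AtomisticToContinuum-BECSwapOverlap — note: route-repair planner (rrepair-AtomisticToContinuum-BECRigidi-da6de746), closing on merits: superseded by route-AtomisticToContinuum-BECSwapOverlap (same target X = Penrose–Onsager II swap overlap of δ(N)-near-minimisers, same frame; the affinity / insertion-tolerance reading of X is route-AtomisticT. The file is kept as the record of this route; refuted decls are indexed as negative knowledge (`ledger negatives`).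

# Route BECRigidityTolerance — ground-state BEC as swap tolerance of the ground-state point process,
decided by pair-dominated move costs with a d>α infrared remainder

X (SWAP-OVERLAP CONDENSATION; spine card rigidity-tolerance-dichotomy). It suffices to show: for
every repulsive finite-range radial v there is ρ₀ > 0 such that for 0 < ρ < ρ₀ there is c > 0 with:
for all large N there is δ > 0 such that EVERY δ-near-minimiser Ψ of the Dirichlet N-body energy in
the box Λ of side L = (N/ρ)^{1/3} has swap overlap ≥ c in each coordinate i: ∫∫ Ψ(X) conj
Ψ(X^{i←y_i}) Ψ(Y) conj Ψ(Y^{i←x_i}) dX dY = tr(γ_Ψ²)/N² ≥ c (X^{i←y} = X with particle i moved to y;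
γ_Ψ the one-particle density matrix). This is Penrose–Onsager's criterion II (A₂ = e^{O(1)}) for
near-minimisers. THE LINE (point-process reading): for Ψ ≥ 0, p = Ψ² is a symmetric point process on
Λ and tr γ²/N² is the Hellinger AFFINITY of p⊗p with its one-point-swapped image = E over two
INDEPENDENT environments X̂, X̂' of BC(p(·|X̂), p(·|X̂'))² (Bhattacharyya overlap of the conditional
laws of the last particle): ground-state BEC ⟺ quantitative insertion/move TOLERANCE of the
ground-state point process. Planner finding (see Why this line): tolerance is NOT decided by
quasi-Gibbs structure plus the hyperuniformity exponent; it is decided by ADDITIVE (pair-dominated)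
one-particle move costs plus an infrared remainder whose one-particle oscillation is finite iff d >
α = 1 — the card's α-vs-d dichotomy lives in that remainder. X is derived inside the route as
ToleranceCriterion(PairDominance) via PhaseReduction.
Lean: `∀ v : ℝ → ENNReal,
Literature.MathematicalPhysics.QuantumManyBody.BoseGas.IsRepulsiveFiniteRange v → ∃ ρ₀ : ℝ, 0 < ρ₀ ∧
∀ ρ : ℝ, 0 < ρ → ρ < ρ₀ → ∃ c : ℝ, 0 < c ∧ ∀ᶠ N : ℕ in Filter.atTop, ∃ δ : ENNReal, 0 < δ ∧ ∀ Ψ :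
Literature.MathematicalPhysics.QuantumManyBody.BoseGas.TrialState N
(Literature.MathematicalPhysics.QuantumManyBody.BoseGas.sideLength ρ N),
Literature.MathematicalPhysics.QuantumManyBody.BoseGas.energy v Ψ ≤
Literature.MathematicalPhysics.QuantumManyBody.BoseGas.groundStateEnergy v N
(Literature.MathematicalPhysics.QuantumManyBody.BoseGas.sideLength ρ N) + δ → ∀ i : Fin N, c ≤ ‖∫ q
: Literature.MathematicalPhysics.QuantumManyBody.BoseGas.Config N ×
Literature.MathematicalPhysics.QuantumManyBody.BoseGas.Config N, Ψ.ψ q.1 * conj (Ψ.ψ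
(Function.update q.1 i (q.2 i))) * (Ψ.ψ q.2 * conj (Ψ.ψ (Function.update q.2 i (q.1 i))))‖`

## Assembly
X → BoseEinsteinCondensation is functional analysis over the Literature definitions: for a
δ-near-minimiser Ψ, tr γ_Ψ² = N²·(swap overlap) ≥ cN²; tr γ³·tr γ ≥ (tr γ²)² by Cauchy–Schwarz for
the positive form (A,B) ↦ tr(A*γ_Ψ B) on span{1, γ_Ψ} (positivity: tr(A*γA) = N∫dX̂ ‖AΨ(·,X̂)‖² ≥ 0;
all traces are iterated integrals of Ψ, no spectral theorem), and tr γ³ = ∫dy ⟨g_y, γ g_y⟩ with g_y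
= γ(·,y), so some normalised measurable mode φ = g_y/‖g_y‖ has occupation ⟨φ,γφ⟩ ≥ tr γ³/tr γ² ≥ tr
γ²/N ≥ cN; then occupation_le_maxOccupation and le_condensateNumber (δ > 0) give HasGroundStateBEC v
ρ with constant c, hence the conjunct. Inside the route X itself is reached as ToleranceCriterion →
PairDominance → (affinity form) → PhaseReduction → X (glue = bookkeeping: L³/N = 1/ρ by
div_sideLength_pow_three; filed after a crux closes).

Rationale: WHY THIS LINE. Penrose–Onsager criterion II turns ground-state BEC into a statement about ONE
probability measure: for Ψ ≥ 0 the normalised swap overlap tr γ²/N² is the Hellinger affinity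
between p⊗p (p = Ψ²) and its image under swapping one particle between the two copies, equivalently
E_{X̂,X̂'} BC(p(·|X̂),p(·|X̂'))², so "no BEC" = asymptotic mutual singularity of the conditional law
of the last particle under independent environments — the quantitative form of number rigidity /
insertion intolerance (GhoshPeres2017, HolroydSoo2013, arXiv:1409.4490), while BEC = quantitative
tolerance; this imports the rigidity–tolerance theory of point processes (DereudreVasseur2023 and
Thoma2026: non-rigidity of long-range Riesz/Coulomb gases via canonical DLR equations and transport
of the deficit to infinity; arXiv:2409.18519 Thm 1–2: linear rigidity iff ∫ s⁻¹ = ∞) into the T = 0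
Bose problem with the explicit dictionary point ↔ boson, move cocycle ↔ γ(x,y), swap affinity ↔ tr
γ², rigidity ↔ absence of ODLRO. Planner's correction of the card: canonical quasi-Gibbs structure +
hyperuniformity exponent α < d do NOT imply tolerance — a parity-locked state p = ∏_cells cos²(π
n_c/2)·p₀ with supercells ℓ ≪ R ≪ L keeps the canonical conditional laws and S(k), costs only
O(N/R²) kinetic energy, and has affinity ~ (R/L)³ → 0 (near-minimality excludes it only because δ is
chosen after N); perturbed lattices at small σ (arXiv:1409.4490) and α ≥ 3 fields show exponents
alone do not decide either. What decides is ADDITIVITY of the one-particle move cost: if log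
p(X^{i←y}) − log p(X) is a difference of dilute PAIR sums ∑_j u(|y−x_j|) − ∑_j u(|x_i−x_j|) (u = −2
log f, f ≤ 1) up to a remainder with small averaged Hellinger oscillation, the two-environment
overlap is bounded below (spatial averaging over y ∈ Λ, Penrose1963/Reatto1969-type computation);
for the Bose ground state the pair part is the scattering correlation hole below the healing length
and the remainder carries the phonon tail u ~ 1/r² (ReattoChester1967) whose one-particle
oscillation has variance ~ ρ∫|û|²S d^dk ~ ∫k^{d−2}dk = O((ρa³)^{1/2}) in d = 3, finite in d = 2,
log-divergent in d = 1 — exactly the T = 0 dimension dependence (LiebLiniger1963/Girardeau1960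
algebraic decay in 1D). Hence two cruxes: PairDominance (Bose-specific, where d > α enters) and
ToleranceCriterion (pure probability on (ℝ³)^N); the point-process shadow of the conjunct is a
quantitative cousin of the OPEN case s = d−1 of Riesz-gas non-rigidity (Thoma2026 §1:
"(non-)rigidity of the Riesz gas with s ∈ (d−2, d−1] remains open"). No energy-to-depletion
conversion at kinetic-gap scale is used anywhere (LiebSeiringerSolovejYngvason2005 Ch. 5 barrier).

RANKED CRUXES. #0 SwapOverlapCondensation (target) — X as in § Thesis: every δ-near-minimiser of the
Dirichlet N-body energy at density ρ < ρ₀(v) has normalised swap overlap tr(γ_Ψ²)/N² ≥ c(v,ρ) > 0 in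
each coordinate, for all large N and some δ = δ(N) > 0. (why it might fail: it is equivalent
(Penrose–Onsager (5)–(7)) to BEC of all near-minimisers, i.e. to the conjunct itself; fails iff the
dilute Bose gas does not condense at T = 0.) [PenroseOnsager1956, LiebSeiringerSolovejYngvason2005]
#2 PairDominance (crux) — (card crux Q made quantitative) for every repulsive finite-range v and all
η₀, σ₀ > 0 there is ρ₀ > 0 such that for 0 < ρ < ρ₀ there is a measurable radial pair factor f : ℝ →
[0,1], DILUTE at density ρ (ρ ∫_{ℝ³}(1 − f(|x|)²)dx ≤ η₀), such that for all large N, some δ > 0 and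
every δ-near-minimiser Ψ (L = (N/ρ)^{1/3}) the averaged move-Hellinger defect of |Ψ| relative to the
pair weight F_i(X) = ∏_{j≠i} f(|x_i − x_j|) is small: D_i(Ψ,f) := ∫_{Λ^N} dX ∫_Λ dy (
|Ψ(X^{i←y})|·F_i(X) − |Ψ(X)|·F_i(X^{i←y}) )² ≤ σ₀² L³ (D_i = 0 iff the one-particle move costs of
|Ψ|² are exactly those of the Jastrow/Gibbs measure ∏ f²). Expected f: the two-body scattering
solution cut off smoothly at R_f with a ≪ R_f ≪ healing length; expected remainder: phonon tail +
three-body terms, O((ρa³)^{1/4}) in Hellinger norm, plus a wall layer O(ξ/L). [difficulty: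
open-problem] (why it might fail: asserts log|Ψ₀| is pair-dominated with L²-small one-particle
remainder; the 1/r² phonon tail and 3-body terms are only perturbatively known (no convergent
expansion for log Ψ₀ in the TL); in d=1 the same remainder diverges ~log N, so any proof must use d
≥ 2.) [ReattoChester1967, Reatto1969, LiebSeiringerSolovejYngvason2005, FournaisSolovej2020,
LiebLiniger1963]
#3 ToleranceCriterion (crux) — (card crux T, tolerance theorem, pure probability on (ℝ³)^N) there
are universal η₀, σ₀, c > 0 such that for every N, every box side L > 0, every measurable radial
pair factor f : ℝ → [0,1] dilute at density N/L³ ((N/L³)∫(1 − f(|x|)²)dx ≤ η₀) and every symmetric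
normalised C¹ Dirichlet state Ψ on Λ_L^N: if the move-Hellinger defect D_i(Ψ,f) ≤ σ₀² L³ then the
swap AFFINITY of the point process |Ψ|² is ≥ c: ∫∫ |Ψ(X)||Ψ(X^{i←y_i})||Ψ(Y)||Ψ(Y^{i←x_i})| dX dY ≥
c ("dilute pair-dominated symmetric densities are swap/insertion tolerant, quantitatively and
uniformly in N"). Mechanism foreseen: affinity = E_{X̂,X̂'} BC(p(·|X̂),p(·|X̂'))² ≥ (∫_Λ dy (E
√p(y|X̂))²)²; with p(y|X̂) ≈ F(y|X̂)²/Z(X̂) the y-average over the box self-averages (Z/L³ ≈ const,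
F close to 1 off an η₀-fraction of the volume). [difficulty: L] (why it might fail: the averaged
(L²) defect bound may not pass to the two-environment overlap without a
reverse-Jensen/non-intermittency step (defect concentrated on rare environments); walls and rare
dense clusters enter the universal constants; no quantitative tolerance theorem exists in print.)
[HolroydSoo2013, arXiv:1409.4490, DereudreVasseur2023, Thoma2026, GhoshLebowitz2017, Penrose1963,
PenroseOnsager1956]
#9 DiluteJastrowTolerance (support) — the exact-pair special case of ToleranceCriterion (defect
zero): there are universal η₀, c > 0 such that every normalised Dirichlet trial state of JASTROW
form |Ψ(X)| = Z ∏_i χ(x_i) ∏_{i<j} f(|x_i − x_j|) (0 ≤ χ ≤ 1 a one-body boundary factor equal to 1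
on the inner box [L/4, 3L/4]³; f : ℝ → [0,1] measurable, dilute: (N/L³)∫(1 − f²) ≤ η₀) has swap
affinity ≥ c. Low-density Bijl–Dingle–Jastrow condensation; cluster-expansion regime (Penrose1963
convergence), Penrose–Onsager §6-type estimate made rigorous. [difficulty: M] [PenroseOnsager1956,
Penrose1963, Reatto1969]
#9 PhaseReduction (support) — the |Ψ|-affinity form of X for near-minimisers implies the overlap
form X (complex Ψ): at fixed N let δ → 0, near-minimisers converge to the ground space (compact
resolvent), the Dirichlet ground state is unique and positive up to phase for v finite a.e.
(positivity-improving semigroup), affinity and overlap coincide on nonnegative states and both are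
L²-continuous in Ψ; for hard cores (v = ⊤ on [0,a]) uniqueness needs connectedness of the low-energy
hard-sphere configuration domain — the one caveat. [difficulty: M]
[LiebSeiringerSolovejYngvason2005, PenroseOnsager1956]

TWO-LAYER PLAN. Foreseen glue (not filed now): CruxGlue := ToleranceCriterion → PairDominance →
AffinityForm (the antecedent of PhaseReduction), pure bookkeeping once both cruxes stand; if
ToleranceCriterion closes first, PairDominance may be split as PairDominance ⇐
ShortRangeJastrowStructure (scattering-hole factor below the healing length, defect from the hole
alone) → InfraredRemainderBound (one-particle oscillation of the phonon tail + 3-body part ≤ σ₀²/2,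
the d > α step) → PairDominance.

KILL CRITERIA. Refutation of ToleranceCriterion by a dilute pair-dominated symmetric density with
vanishing affinity (a counterexample family with D ≤ σ₀²L³ for every σ₀ and affinity → 0) closes the
route outright unless the witness violates a natural extra hypothesis the Bose ground state has
(then restate once). Refutation of PairDominance (e.g. a proof that the one-particle Hellinger
remainder of Dirichlet near-minimisers stays ≥ const as ρ → 0 in d = 3) closes the route: the line
then says nothing beyond Penrose–Onsager. Refutation of PhaseReduction for hard cores forces a pivot
to finite potentials (restate with v < ⊤) — not a kill. A proof of BEC by any other route moots this
one (superseded).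

NOT DECOMPOSED YET. The glue ToleranceCriterion → PairDominance → affinity form; the wall layer
(Dirichlet profile within a healing length of ∂Λ contributes O(ξ/L) to the defect); the choice of f
(scattering solution, cut-off scale R_f with ρ a R_f² ≤ η₀); the reverse-Jensen step inside
ToleranceCriterion; the negative half of the dichotomy (rigidity ⇒ no ODLRO: screened number
rigidity forces affinity → 0 — true for parity-locked, crystalline and 1D Luttinger states, worth a
Literature lemma but not load-bearing); hyperuniformity bounds S_N(k) ≶ |k| (card crux H) are
deliberately NOT items: in d = 3 tolerance needs no hyperuniformity hypothesis, the exponent enters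
only through û ~ 1/k ⇔ S ~ k inside PairDominance's remainder.

CHEAPEST FALSIFIER. For ToleranceCriterion: take f ≡ 1 and Ψ² a parity-locked or fragmented product
state — both give defect D ≈ 2L³ ≫ σ₀²L³, so they are excluded (checked by hand, see Why this line);
the next cheapest is a Monte-Carlo estimate (kit) of D and of the affinity for √(dilute hard-sphere
Gibbs measure) at packing fraction 10⁻³…10⁻¹, which must show affinity bounded below while D = 0.
For PairDominance: the 1D analogue — for Lieb–Liniger/Tonks near-minimisers the same defect with the
best pair factor must grow like log N (Girardeau1960: λ_max ~ √N); if instead a 3D computation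
(Bogoliubov/Jastrow variational ground state, kit) showed the one-particle remainder variance NOT
scaling like (ρa³)^{1/2}, the crux is dead.

NUMBERS. Bogoliubov depletion 1 − n₀/N = (8/3√π)(ρa³)^{1/2} (LiebSeiringerSolovejYngvason2005 Ch.
5); expected remainder variance in PairDominance ~ C(ρa³)^{1/2}, so σ₀² ~ (ρa³)^{1/2} is the natural
scale; dilution η₀ ≈ ρ(4πaR_f² + 4πa³/3) with a ≪ R_f ≪ ξ = (8πρa)^{-1/2}; P–O estimate for He II:
n₀/N ≈ 0.08 (PenroseOnsager1956 §6, hard-sphere Jastrow at liquid density — outside the dilute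
regime of this route).

DEFINITION REQUESTS. None now. If ToleranceCriterion's prover wants them: `swapAffinity`,
`moveDefect` as named functionals under
Summits/AtomisticToContinuum/BoseEinsteinCondensation/Theorems (inlined in the items today).

Novelty: Searches (2026-08-15): lit search --source zbmath "rigidity tolerance perturbed lattices Peres Sly"
(2: arXiv:1409.4490, arXiv:1601.04216), "number rigidity Riesz gas DLR equations" (1:
DereudreVasseur2023), "rigidity random stationary measures Lachieze-Rey" (2: arXiv:2409.18519,
arXiv:2510.18392), "Thoma non-rigidity Coulomb gas" (0) → crossref "overcrowding rigidity Coulomb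
gas" (Thoma2026 = doi:10.1214/25-aop1787, Chatterjee2019 doi:10.1007/s00440-019-00912-6),
"off-diagonal long-range order point process Palm" (0); lit search --source crossref "ground state
wave function point process Bose condensation Jastrow" (Reatto/Masserini Jastrow papers,
MarchGalasiewicz1976 doi:10.1080/00319107608084110), "hyperuniformity quantum ground state structure
factor Reatto Chester" (ReattoChester1967), "insertion tolerance Gibbs point process quantitative"
(HolroydSoo2013 only), "Bose-Einstein condensation quasi-invariance measure translation" (nothing);
lit read arXiv:2104.09408 pp1-8 (DV conjecture s ≤ d−1 rigid), arXiv:2303.11486 pp1-3 (Thoma: d ≥ 3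
Coulomb not rigid; s ∈ (d−2,d−1] open), arXiv:2409.18519 pp2-3,8,13,21; lit frontier
AtomisticToContinuum --since 2020 and lit bridges --cross any (no point-process/BEC bridge); lit
galaxy search "off-diagonal long-range order point process" --star all: queue saturated (rc 1),
arXiv/OpenAlex APIs 429 — recorded.
Nearest prior art found: arXiv:2409.18519 (Lachièze-Rey 2024, linear rigidity iff ∫s⁻¹ = ∞ — the
α-vs-d law for LINEAR rigidity,  [refs: 10.1214/25-aop1787, 10.1007/s00440-019-00912-6, 10.1080/00319107608084110, 1409.4490, 1601.04216, 2409.18519, 2510.18392, 2104.09408, 2303.11486, doi:10.1214/25-aop1787, doi:10.1007/s00440-019-00912-6, doi:10.1080/00319107608084110, DereudreVasseur2023, Thoma2026, ReattoChester1967, HolroydSoo2013, Reatto1969, PenroseOnsager1956]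

Barriers (technique_class: point-process-rigidity insertion-tolerance quasi-Gibbs): - technique_class: point-process-rigidity insertion-tolerance quasi-Gibbs
- Literature.Barriers.AtomisticToContinuum.KineticGapLengthScales: evaded — no
depletion-from-excess-energy step at any length scale; the only energy input is near-minimality with
δ(N) → 0 at fixed N, and the assembly goes through tr γ² (Penrose–Onsager II), not through a kinetic
gap.
- Literature.Barriers.AtomisticToContinuum.EnergyAsymptoticsWithoutCondensation: evaded — energy
asymptotics are never converted into condensation; PairDominance is a structural statement about
move costs of |Ψ₀|², and its 1D failure (remainder ~ log N for Lieb–Liniger) is consistent with the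
barrier's witness.
- Literature.Barriers.AtomisticToContinuum.PitaevskiiStringariOneDimension: consistent — in d = 1
the infrared remainder diverges and the affinity decays algebraically; the route's cruxes are stated
in d = 3 only and PairDominance's proof must use d ≥ 2.
- Literature.Barriers.AtomisticToContinuum.OneDimensionalHardCore: consistent — Girardeau's
|free-fermion| state is pair-exact (f = |sin|-type) but NOT dilute-pair-dominated in the route's
sense at fixed 1D density; the 3D statements do not touch it.
- Literature.Barriers.AtomisticToContinuum.HohenbergLowDimension: orthogonal — T = 0 throughout; no
thermal fluctuations.
- Literature.Barriers.AtomisticToContinuum.BogoliubovPerturbationInfrared: evaded — no perturbative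
expansion; the infrared enters once, as the L²-size of the phonon-tail move cost, with a full power

History (route lifecycle, newest last):
- 2026-08-15T12:32:08Z · CLOSED superseded — superseded:route-AtomisticToContinuum-BECSwapOverlap (planner-AtomisticToContinuum-route-AtomisticToContinuum-BECR)

sub-problem: BoseEinsteinCondensation · status: closed(superseded) · opened planner-plancard-AtomisticToContinuum-BoseEin-d4c109c5-0 2026-08-15T11:40:53Z · rev 0 · ledger route-AtomisticToContinuum-BECRigidityTolerance
GENERATED by the gate from the ledger (D-0016/17). Provers cite these decls: `theorem foo : Summit.AtomisticToContinuum.BoseEinsteinCondensation.Theses.BECRigidityTolerance.<Decl> := …` in Summits/AtomisticToContinuum/BoseEinsteinCondensation/Theorems/<Name>.lean.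
-/

namespace Summit.AtomisticToContinuum.BoseEinsteinCondensation.Theses.BECRigidityTolerance

open scoped BigOperators Topology Manifold Classical MeasureTheory ProbabilityTheory Matrix InnerProductSpace ComplexConjugate ContinuousMap
open Filter Set Function TopologicalSpace MeasureTheory

attribute [summit_statement] _root_.BoseEinsteinCondensation

/-- item stmt-AtomisticToContinuum-5359 · target · rank 0 · closed · moot by None · by planner
why it might fail: it is equivalent (Penrose–Onsager (5)–(7)) to BEC of all near-minimisers, i.e. to the conjunct itself; fails iff the dilute Bose gas does not condense at T = 0.
sources: PenroseOnsager1956, LiebSeiringerSolovejYngvason2005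
[target] X as in § Thesis: every δ-near-minimiser of the Dirichlet N-body energy at density ρ <
ρ₀(v) has normalised swap overlap tr(γ_Ψ²)/N² ≥ c(v,ρ) > 0 in each coordinate, for all large N and
some δ = δ(N) > 0. -/
@[route_item "route-AtomisticToContinuum-BECRigidityTolerance"]
def SwapOverlapCondensation : Prop :=
  ∀ v : ℝ → ENNReal, Literature.MathematicalPhysics.QuantumManyBody.BoseGas.IsRepulsiveFiniteRange v → ∃ ρ₀ : ℝ, 0 < ρ₀ ∧ ∀ ρ : ℝ, 0 < ρ → ρ < ρ₀ → ∃ c : ℝ, 0 < c ∧ ∀ᶠ N : ℕ in Filter.atTop, ∃ δ : ENNReal, 0 < δ ∧ ∀ Ψ : Literature.MathematicalPhysics.QuantumManyBody.BoseGas.TrialState N (Literature.MathematicalPhysics.QuantumManyBody.BoseGas.sideLength ρ N), Literature.MathematicalPhysics.QuantumManyBody.BoseGas.energy v Ψ ≤ Literature.MathematicalPhysics.QuantumManyBody.BoseGas.groundStateEnergy v N (Literature.MathematicalPhysics.QuantumManyBody.BoseGas.sideLength ρ N) + δ → ∀ i : Fin N, c ≤ ‖∫ q : Literature.MathematicalPhysics.QuantumManyBody.BoseGas.Config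 N × Literature.MathematicalPhysics.QuantumManyBody.BoseGas.Config N, Ψ.ψ q.1 * conj (Ψ.ψ (Function.update q.1 i (q.2 i))) * (Ψ.ψ q.2 * conj (Ψ.ψ (Function.update q.2 i (q.1 i))))‖

/-- item stmt-AtomisticToContinuum-5360 · crux · rank 2 · closed · moot by None · by planner
why it might fail: asserts log|Ψ₀| is pair-dominated with L²-small one-particle remainder; the 1/r² phonon tail and 3-body terms are only perturbatively known (no convergent expansion for log Ψ₀ in the TL); in d=1 the same remainder diverges ~log N, so any proof must use d ≥ 2.
sources: ReattoChester1967, Reatto1969, LiebSeiringerSolovejYngvason2005, FournaisSolovej2020, LiebLiniger1963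
[crux] (card crux Q made quantitative) for every repulsive finite-range v and all η₀, σ₀ > 0 there
is ρ₀ > 0 such that for 0 < ρ < ρ₀ there is a measurable radial pair factor f : ℝ → [0,1], DILUTE at
density ρ (ρ ∫_{ℝ³}(1 − f(|x|)²)dx ≤ η₀), such that for all large N, some δ > 0 and every
δ-near-minimiser Ψ (L = (N/ρ)^{1/3}) the averaged move-Hellinger defect of |Ψ| relative to the pair
weight F_i(X) = ∏_{j≠i} f(|x_i − x_j|) is small: D_i(Ψ,f) := ∫_{Λ^N} dX ∫_Λ dy ( |Ψ(X^{i←y})|·F_i(X)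
− |Ψ(X)|·F_i(X^{i←y}) )² ≤ σ₀² L³ (D_i = 0 iff the one-particle move costs of |Ψ|² are exactly those
of the Jastrow/Gibbs measure ∏ f²). Expected f: the two-body scattering solution cut off smoothly at
R_f with a ≪ R_f ≪ healing length; expected remainder: phonon tail + three-body terms,
O((ρa³)^{1/4}) in Hellinger norm, plus a wall layer O(ξ/L). [difficulty: open-problem] -/
@[route_item "route-AtomisticToContinuum-BECRigidityTolerance"]
def PairDominance : Prop :=
  ∀ v : ℝ → ENNReal, Literature.MathematicalPhysics.QuantumManyBody.BoseGas.IsRepulsiveFiniteRange v → ∀ η₀ σ₀ : ℝ, 0 < η₀ → 0 < σ₀ → ∃ ρ₀ : ℝ, 0 < ρ₀ ∧ ∀ ρ : ℝ, 0 < ρ → ρ < ρ₀ → ∃ f : ℝ → ℝ, Measurable f ∧ (∀ r, 0 ≤ f r ∧ f r ≤ 1) ∧ (∫⁻ x : Literature.MathematicalPhysics.QuantumManyBody.BoseGas.Space, ENNReal.ofReal (1 - f ‖x‖ ^ 2)) ≤ ENNReal.ofReal (η₀ / ρ) ∧ ∀ᶠ N : ℕ in Filter.atTop, ∃ δ : ENNReal,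 0 < δ ∧ ∀ Ψ : Literature.MathematicalPhysics.QuantumManyBody.BoseGas.TrialState N (Literature.MathematicalPhysics.QuantumManyBody.BoseGas.sideLength ρ N), Literature.MathematicalPhysics.QuantumManyBody.BoseGas.energy v Ψ ≤ Literature.MathematicalPhysics.QuantumManyBody.BoseGas.groundStateEnergy v N (Literature.MathematicalPhysics.QuantumManyBody.BoseGas.sideLength ρ N) + δ → ∀ i : Fin N, (∫⁻ X in Literature.MathematicalPhysics.QuantumManyBody.BoseGas.boxN N (Literature.MathematicalPhysics.QuantumManyBody.BoseGas.sideLength ρ N), ∫⁻ y in Literature.MathematicalPhysics.QuantumManyBody.BoseGas.box (Literature.MathematicalPhysics.QuantumManyBody.BoseGas.sideLength ρ N), ENNReal.ofReal ((‖Ψ.ψ (Function.update X i y)‖ * (∏ j ∈ Finset.univ.erase i, f (dist (X i) (X j))) - ‖Ψ.ψ X‖ * (∏ j ∈ Finset.univ.erase i, f (dist y (X j)))) ^ 2)) ≤ ENNReal.ofReal (σ₀ ^ 2 * Literature.MathematicalPhysics.QuantumManyBody.BoseGas.sideLength ρ N ^ 3)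

/-- item stmt-AtomisticToContinuum-5361 · crux · rank 3 · closed · moot by None · by planner
why it might fail: the averaged (L²) defect bound may not pass to the two-environment overlap without a reverse-Jensen/non-intermittency step (defect concentrated on rare environments); walls and rare dense clusters enter the universal constants; no quantitative tolerance theorem exists in print.
sources: HolroydSoo2013, arXiv:1409.4490, DereudreVasseur2023, Thoma2026, GhoshLebowitz2017, Penrose1963
[crux] (card crux T, tolerance theorem, pure probability on (ℝ³)^N) there are universal η₀, σ₀, c >
0 such that for every N, every box side L > 0, every measurable radial pair factor f : ℝ → [0,1]
dilute at density N/L³ ((N/L³)∫(1 − f(|x|)²)dx ≤ η₀) and every symmetric normalised C¹ Dirichlet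
state Ψ on Λ_L^N: if the move-Hellinger defect D_i(Ψ,f) ≤ σ₀² L³ then the swap AFFINITY of the point
process |Ψ|² is ≥ c: ∫∫ |Ψ(X)||Ψ(X^{i←y_i})||Ψ(Y)||Ψ(Y^{i←x_i})| dX dY ≥ c ("dilute pair-dominated
symmetric densities are swap/insertion tolerant, quantitatively and uniformly in N"). Mechanism
foreseen: affinity = E_{X̂,X̂'} BC(p(·|X̂),p(·|X̂'))² ≥ (∫_Λ dy (E √p(y|X̂))²)²; with p(y|X̂) ≈
F(y|X̂)²/Z(X̂) the y-average over the box self-averages (Z/L³ ≈ const, F close to 1 off an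
η₀-fraction of the volume). [difficulty: L] -/
@[route_item "route-AtomisticToContinuum-BECRigidityTolerance"]
def ToleranceCriterion : Prop :=
  ∃ η₀ σ₀ c : ℝ, 0 < η₀ ∧ 0 < σ₀ ∧ 0 < c ∧ ∀ (N : ℕ) (L : ℝ) (f : ℝ → ℝ), 0 < L → Measurable f → (∀ r, 0 ≤ f r ∧ f r ≤ 1) → (∫⁻ x : Literature.MathematicalPhysics.QuantumManyBody.BoseGas.Space, ENNReal.ofReal (1 - f ‖x‖ ^ 2)) ≤ ENNReal.ofReal (η₀ * L ^ 3 / N) → ∀ Ψ : Literature.MathematicalPhysics.QuantumManyBody.BoseGas.TrialState N L, ∀ i : Fin N, (∫⁻ X in Literature.MathematicalPhysics.QuantumManyBody.BoseGas.boxN N L, ∫⁻ y in Literature.MathematicalPhysics.QuantumManyBody.BoseGas.box L, ENNReal.ofReal ((‖Ψ.ψ (Function.update X i y)‖ * (∏ j ∈ Finset.univ.erase i, f (dist (X i) (X j))) - ‖Ψ.ψ X‖ * (∏ j ∈ Finset.univ.erase i, f (dist y (X j)))) ^ 2)) ≤ ENNReal.ofReal (σ₀ ^ 2 * L ^ 3)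 → ENNReal.ofReal c ≤ ∫⁻ q : Literature.MathematicalPhysics.QuantumManyBody.BoseGas.Config N × Literature.MathematicalPhysics.QuantumManyBody.BoseGas.Config N, (‖Ψ.ψ q.1‖₊ : ENNReal) * (‖Ψ.ψ (Function.update q.1 i (q.2 i))‖₊ : ENNReal) * ((‖Ψ.ψ q.2‖₊ : ENNReal) * (‖Ψ.ψ (Function.update q.2 i (q.1 i))‖₊ : ENNReal))

/-- item stmt-AtomisticToContinuum-5362 · support · rank 9 · closed · moot by None · by planner
sources: PenroseOnsager1956, Penrose1963, Reatto1969
[support] the exact-pair special case of ToleranceCriterion (defect zero): there are universal η₀, c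
> 0 such that every normalised Dirichlet trial state of JASTROW form |Ψ(X)| = Z ∏_i χ(x_i) ∏_{i<j}
f(|x_i − x_j|) (0 ≤ χ ≤ 1 a one-body boundary factor equal to 1 on the inner box [L/4, 3L/4]³; f : ℝ
→ [0,1] measurable, dilute: (N/L³)∫(1 − f²) ≤ η₀) has swap affinity ≥ c. Low-density
Bijl–Dingle–Jastrow condensation; cluster-expansion regime (Penrose1963 convergence),
Penrose–Onsager §6-type estimate made rigorous. [difficulty: M] -/
@[route_item "route-AtomisticToContinuum-BECRigidityTolerance"]
def DiluteJastrowTolerance : Prop :=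
  ∃ η₀ c : ℝ, 0 < η₀ ∧ 0 < c ∧ ∀ (N : ℕ) (L : ℝ) (f : ℝ → ℝ), 0 < L → Measurable f → (∀ r, 0 ≤ f r ∧ f r ≤ 1) → (∫⁻ x : Literature.MathematicalPhysics.QuantumManyBody.BoseGas.Space, ENNReal.ofReal (1 - f ‖x‖ ^ 2)) ≤ ENNReal.ofReal (η₀ * L ^ 3 / N) → ∀ Ψ : Literature.MathematicalPhysics.QuantumManyBody.BoseGas.TrialState N L, (∃ Z : ℝ, ∃ χ : Literature.MathematicalPhysics.QuantumManyBody.BoseGas.Space → ℝ, (∀ x, 0 ≤ χ x ∧ χ x ≤ 1) ∧ (∀ x : Literature.MathematicalPhysics.QuantumManyBody.BoseGas.Space, (∀ k : Fin 3, x k ∈ Set.Icc (L / 4) (3 * L / 4)) → χ x = 1) ∧ ∀ X, ‖Ψ.ψ X‖ = Z * (∏ i : Fin N, χ (X i)) * ∏ i : Fin N, ∏ j ∈ Finset.univ.filter (fun j => i < j), f (dist (X i) (X j))) → ∀ i : Fin N, ENNReal.ofReal c ≤ ∫⁻ q : Literature.MathematicalPhysics.QuantumManyBody.BoseGas.Config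 N × Literature.MathematicalPhysics.QuantumManyBody.BoseGas.Config N, (‖Ψ.ψ q.1‖₊ : ENNReal) * (‖Ψ.ψ (Function.update q.1 i (q.2 i))‖₊ : ENNReal) * ((‖Ψ.ψ q.2‖₊ : ENNReal) * (‖Ψ.ψ (Function.update q.2 i (q.1 i))‖₊ : ENNReal))

/-- item stmt-AtomisticToContinuum-5363 · support · rank 9 · closed · moot by None · by planner
sources: LiebSeiringerSolovejYngvason2005, PenroseOnsager1956
[support] the |Ψ|-affinity form of X for near-minimisers implies the overlap form X (complex Ψ): at
fixed N let δ → 0, near-minimisers converge to the ground space (compact resolvent), the Dirichlet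
ground state is unique and positive up to phase for v finite a.e. (positivity-improving semigroup),
affinity and overlap coincide on nonnegative states and both are L²-continuous in Ψ; for hard cores
(v = ⊤ on [0,a]) uniqueness needs connectedness of the low-energy hard-sphere configuration domain —
the one caveat. [difficulty: M] -/
@[route_item "route-AtomisticToContinuum-BECRigidityTolerance"]
def PhaseReduction : Prop :=
  (∀ v : ℝ → ENNReal, Literature.MathematicalPhysics.QuantumManyBody.BoseGas.IsRepulsiveFiniteRange v → ∃ ρ₀ : ℝ, 0 < ρ₀ ∧ ∀ ρ : ℝ, 0 < ρ → ρ < ρ₀ → ∃ c : ℝ, 0 < c ∧ ∀ᶠ N : ℕ in Filter.atTop, ∃ δ : ENNReal, 0 < δ ∧ ∀ Ψ : Literature.MathematicalPhysics.QuantumManyBody.BoseGas.TrialState N (Literature.MathematicalPhysics.QuantumManyBody.BoseGas.sideLength ρ N), Literature.MathematicalPhysics.QuantumManyBody.BoseGas.energy v Ψ ≤ Literature.MathematicalPhysics.QuantumManyBody.BoseGas.groundStateEnergy v N (Literature.MathematicalPhysics.QuantumManyBody.BoseGas.sideLength ρ N) + δ → ∀ i : Fin N, ENNReal.ofReal c ≤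 ∫⁻ q : Literature.MathematicalPhysics.QuantumManyBody.BoseGas.Config N × Literature.MathematicalPhysics.QuantumManyBody.BoseGas.Config N, (‖Ψ.ψ q.1‖₊ : ENNReal) * (‖Ψ.ψ (Function.update q.1 i (q.2 i))‖₊ : ENNReal) * ((‖Ψ.ψ q.2‖₊ : ENNReal) * (‖Ψ.ψ (Function.update q.2 i (q.1 i))‖₊ : ENNReal))) → (∀ v : ℝ → ENNReal, Literature.MathematicalPhysics.QuantumManyBody.BoseGas.IsRepulsiveFiniteRange v → ∃ ρ₀ : ℝ, 0 < ρ₀ ∧ ∀ ρ : ℝ, 0 < ρ → ρ < ρ₀ → ∃ c : ℝ, 0 < c ∧ ∀ᶠ N : ℕ in Filter.atTop, ∃ δ : ENNReal, 0 < δ ∧ ∀ Ψ : Literature.MathematicalPhysics.QuantumManyBody.BoseGas.TrialState N (Literature.MathematicalPhysics.QuantumManyBody.BoseGas.sideLength ρ N), Literature.MathematicalPhysics.QuantumManyBody.BoseGas.energy v Ψ ≤ Literature.MathematicalPhysics.QuantumManyBody.BoseGas.groundStateEnergy v N (Literature.MathematicalPhysics.QuantumManyBody.BoseGas.sideLength ρ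 N) + δ → ∀ i : Fin N, c ≤ ‖∫ q : Literature.MathematicalPhysics.QuantumManyBody.BoseGas.Config N × Literature.MathematicalPhysics.QuantumManyBody.BoseGas.Config N, Ψ.ψ q.1 * conj (Ψ.ψ (Function.update q.1 i (q.2 i))) * (Ψ.ψ q.2 * conj (Ψ.ψ (Function.update q.2 i (q.1 i))))‖)

/-- item stmt-AtomisticToContinuum-5364 · assembly · rank 1 · closed · moot by None · by planner
sources: PenroseOnsager1956, LiebSeiringerSolovejYngvason2005
[assembly] SwapOverlapCondensation → BoseEinsteinCondensation (the conjunct, =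
Literature.MathematicalPhysics.QuantumManyBody.BoseGas.BoseEinsteinCondensation). -/
@[route_item "route-AtomisticToContinuum-BECRigidityTolerance"]
def Assembly : Prop :=
  (∀ v : ℝ → ENNReal, Literature.MathematicalPhysics.QuantumManyBody.BoseGas.IsRepulsiveFiniteRange v → ∃ ρ₀ : ℝ, 0 < ρ₀ ∧ ∀ ρ : ℝ, 0 < ρ → ρ < ρ₀ → ∃ c : ℝ, 0 < c ∧ ∀ᶠ N : ℕ in Filter.atTop, ∃ δ : ENNReal, 0 < δ ∧ ∀ Ψ : Literature.MathematicalPhysics.QuantumManyBody.BoseGas.TrialState N (Literature.MathematicalPhysics.QuantumManyBody.BoseGas.sideLength ρ N), Literature.MathematicalPhysics.QuantumManyBody.BoseGas.energy v Ψ ≤ Literature.MathematicalPhysics.QuantumManyBody.BoseGas.groundStateEnergy v N (Literature.MathematicalPhysics.QuantumManyBody.BoseGas.sideLength ρ N) + δ → ∀ i : Fin N, c ≤ ‖∫ q : Literature.MathematicalPhysics.QuantumManyBody.BoseGas.Config N × Literature.MathematicalPhysics.QuantumManyBody.BoseGas.Config N, Ψ.ψ q.1 * conj (Ψ.ψ (Function.update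 q.1 i (q.2 i))) * (Ψ.ψ q.2 * conj (Ψ.ψ (Function.update q.2 i (q.1 i))))‖) → Literature.MathematicalPhysics.QuantumManyBody.BoseGas.BoseEinsteinCondensation

end Summit.AtomisticToContinuum.BoseEinsteinCondensation.Theses.BECRigidityTolerance
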